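import Mathlib
import Literature.Probability.Percolation.PercolationSharpThreshold
import Summits.CriticalPhenomena.CardyFormulaZ2.Theorems.CardySelfRefinementGradientComparabilityStubDcZeroHalfGeSumPivotal
import Summits.CriticalPhenomena.CardyFormulaZ2.Theorems.CardySelfRefinementGradientComparabilityStubExistsPivotalOfNondegenerate
import Summits.CriticalPhenomena.CardyFormulaZ2.Theorems.CardySelfRefinementGradientComparabilityStubPivotalUniformlySmall
import Summits.CriticalPhenomena.CardyFormulaZ2.Theorems.CardySelfRefinementGradientComparabilityStubJointCrossingNondegenerate
import HarnessLib

/-!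
# Crux `GradientComparability` (stmt-CriticalPhenomena-10269), line `Sketch` — the pivotal count
# of a quad family diverges (bond-`ℤ²` at `p = ½`)

Route `CardySelfRefinement`, sub-problem `CriticalPhenomena/CardyFormulaZ2`; vocabulary from
`CardySelfRefinementDefs` (`Aloc`, `window`).

**Theorem (`allEdgesPivotalSum_diverges`).**  For critical bond percolation on `ℤ²` drawn at mesh
`η` (`squareLatticeEmbedding.z`, Schramm–Smirnov closure semantics) and every nonempty finite family
`F` of quads, the expected number of edges pivotal for the joint crossing event
`Σ_{e ∈ window} P_{1/2}(e pivotal for Aloc m F η)` tends to `+∞` as `η → 0⁺`.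

Proof: the tree's Talagrand–Rossignol sharp-threshold inequality
`SharpThreshold.sharpThreshold_event` (`t(1−t) log(t(1−t)/(¼ Σ I_e²)) ≤ 2 Σ I_e` at `p = ½`)
combined with (D1) non-degeneracy `t = P(Aloc) ∈ [c₀, 1 − c₀]` (`stub_jointCrossing_nondegenerate`),
(D2) uniform smallness of single-edge pivotal probabilities (`stub_pivotal_uniformly_small`) and
(D0) positivity of `Σ I_e²` (`stub_exists_pivotal_of_nondegenerate`): if `Σ I_e < N` then
`Σ I_e² ≤ ε Σ I_e < εN`, and `ε = 4u₀e^{−4N/u₀}/N`, `u₀ = c₀(1−c₀)`, forces `4N ≤ 2N`.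
(Talagrand 1994 Thm 1.1; Rossignol 2006 Thm 2.1; Garban–Pete–Schramm 2010 §1 for the statement
that critical crossing events have diverging total influence.)
-/

noncomputable section

namespace Summit.CriticalPhenomena.CardyFormulaZ2.Theorems.CardySelfRefinement

open scoped Topology
open Filter Set MeasureTheory
open Literature.Probability.LatticeModels Literature.Probability.Percolation
open Literature.Probability.Percolation.QuadCrossing
open Summit.CriticalPhenomena.CardyFormulaZ2.Theses.CardySelfRefinement

/-- The window consists of lattice edges. -/
theorem window_subset_edgeSet (m : ℕ) (F : Fin m → Quad (Set.univ : Set ℂ)) (η : ℝ) :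
    window m F η ⊆ (zdGraph 2).edgeSet := by
  intro e he
  simp only [window, Set.mem_iUnion] at he
  obtain ⟨i, hi⟩ := he
  exact hi.2

/-- `Aloc` is determined by the window. -/
theorem determinedBy_Aloc_window (m : ℕ) (F : Fin m → Quad (Set.univ : Set ℂ)) (η : ℝ) :
    DeterminedBy (Aloc m F η) (window m F η) := by
  rw [determinedBy_iff]
  intro ω ω' h
  simp only [Aloc, Set.mem_setOf_eq, h]

/-- **The pivotal count over ALL window edges diverges** (Talagrand–Rossignol
`sharpThreshold_event` ⨉ D0 ⨉ D1 ⨉ D2): if `Σ I_e` stayed below `N` then `Σ I_e² ≤ ε Σ I_e < εN`,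
and with `ε = 4u₀ e^{−4N/u₀}/N` (`u₀ = c₀(1−c₀) ≤ t(1−t)`) the inequality
`t(1−t) log(4t(1−t)/Σ I_e²) ≤ 2 Σ I_e` would give `4N ≤ 2N`. -/
theorem allEdgesPivotalSum_diverges :
    ∀ (m : ℕ) (F : Fin m → Quad (Set.univ : Set ℂ)), 0 < m → ∀ N : ℝ, ∃ η₁ : ℝ, 0 < η₁ ∧
      ∀ η ∈ Set.Ioo 0 η₁, ∀ W : Finset (Sym2 (Site 2)), (↑W : Set (Sym2 (Site 2))) = window m F η →
        N ≤ ∑ e ∈ W, (bondPercolation (zdGraph 2) half).real {ω | IsPivotal (Aloc m F η) e ω} := by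
  intro m F hm N
  obtain ⟨c₀, η₂, hc₀, hη₂, hnd⟩ := stub_jointCrossing_nondegenerate m F hm
  by_cases hN : N ≤ 0
  · refine ⟨η₂, hη₂, fun η hη W hW => hN.trans (Finset.sum_nonneg fun e _ => by positivity)⟩
  rw [not_le] at hN
  -- `u₀ = c₀ (1 − c₀)` bounds `t(1−t)` from below on `[c₀, 1 − c₀]`
  have hc₀le : c₀ ≤ 1 / 2 := by
    have := hnd (η₂ / 2) ⟨by positivity, by linarith⟩
    linarith [this.1, this.2]
  set u₀ : ℝ := c₀ * (1 - c₀) with hu₀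
  have hu₀pos : 0 < u₀ := mul_pos hc₀ (by linarith)
  set ε : ℝ := 4 * u₀ / (N * Real.exp (4 * N / u₀)) with hε
  have hεpos : 0 < ε := by positivity
  obtain ⟨η₃, hη₃, hsmall⟩ := stub_pivotal_uniformly_small m F hm ε hεpos
  refine ⟨min η₂ η₃, lt_min hη₂ hη₃, fun η hη W hW => ?_⟩
  have hη2 : η ∈ Set.Ioo 0 η₂ := ⟨hη.1, lt_of_lt_of_le hη.2 (min_le_left _ _)⟩
  have hη3 : η ∈ Set.Ioo 0 η₃ := ⟨hη.1, lt_of_lt_of_le hη.2 (min_le_right _ _)⟩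
  have hη0 : η ≠ 0 := hη.1.ne'
  set μ := bondPercolation (zdGraph 2) half with hμ
  set t : ℝ := μ.real (Aloc m F η) with ht
  set S₁ : ℝ := ∑ e ∈ W, μ.real {ω | IsPivotal (Aloc m F η) e ω} with hS₁
  set S₂ : ℝ := ∑ e ∈ W, μ.real {ω | IsPivotal (Aloc m F η) e ω} ^ 2 with hS₂
  obtain ⟨ht1, ht2⟩ := hnd η hη2
  have htt : u₀ ≤ t * (1 - t) := by
    have : t * (1 - t) - c₀ * (1 - c₀) = (t - c₀) * (1 - c₀ - t) := by ring
    nlinarith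
  have httpos : 0 < t * (1 - t) := lt_of_lt_of_le hu₀pos htt
  have htt4 : t * (1 - t) ≤ 1 / 4 := by nlinarith [sq_nonneg (t - 1 / 2)]
  have hS₂pos : 0 < S₂ := stub_exists_pivotal_of_nondegenerate m F hη0 httpos W hW
  have hI_nn : ∀ e ∈ W, 0 ≤ μ.real {ω | IsPivotal (Aloc m F η) e ω} := fun e _ => by positivity
  have hS₁nn : 0 ≤ S₁ := Finset.sum_nonneg hI_nn
  -- `S₂ ≤ ε S₁`
  have hS₂le : S₂ ≤ ε * S₁ := by
    rw [hS₂, hS₁, Finset.mul_sum]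
    refine Finset.sum_le_sum fun e he => ?_
    have h1 := hsmall η hη3 e
    have h0 := hI_nn e he
    nlinarith
  -- Talagrand–Rossignol at `p = ½`
  have hhalf : ((half : unitInterval) : ℝ) = 1 / 2 := rfl
  have hTal := SharpThreshold.sharpThreshold_event (G := zdGraph 2) (F := W)
    (hW ▸ window_subset_edgeSet m F η) (isUpperSet_Aloc m F η) (hW ▸ determinedBy_Aloc_window m F η)
    half (by rw [hhalf]; norm_num) (by rw [hhalf]; norm_num) httpos hS₂pos
  rw [hhalf] at hTal
  have h4 : (4 : ℝ) * (1 / 2) ^ 2 * (1 - 1 / 2) ^ 2 = 1 / 4 := by norm_num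
  rw [h4] at hTal
  change t * (1 - t) * Real.log (t * (1 - t) / (1 / 4 * S₂)) ≤ 2 * S₁ at hTal
  -- suppose `S₁ < N` and derive a contradiction
  by_contra hlt
  rw [not_le] at hlt
  have hS₂lt : S₂ < ε * N := lt_of_le_of_lt hS₂le (by nlinarith)
  have hlog : 4 * N / u₀ ≤ Real.log (t * (1 - t) / (1 / 4 * S₂)) := by
    have hq : Real.exp (4 * N / u₀) ≤ t * (1 - t) / (1 / 4 * S₂) := by
      rw [le_div_iff₀ (by positivity)]
      have hexp : 0 < Real.exp (4 * N / u₀) := Real.exp_pos _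
      have hεN : ε * N * Real.exp (4 * N / u₀) = 4 * u₀ := by
        rw [hε]; field_simp
      calc Real.exp (4 * N / u₀) * (1 / 4 * S₂) = (1 / 4) * (S₂ * Real.exp (4 * N / u₀)) := by ring
        _ ≤ (1 / 4) * (ε * N * Real.exp (4 * N / u₀)) :=
            mul_le_mul_of_nonneg_left (mul_le_mul_of_nonneg_right hS₂lt.le hexp.le) (by norm_num)
        _ = u₀ := by rw [hεN]; ring
        _ ≤ t * (1 - t) := htt
    calc 4 * N / u₀ = Real.log (Real.exp (4 * N / u₀)) := (Real.log_exp _).symm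
      _ ≤ Real.log (t * (1 - t) / (1 / 4 * S₂)) := Real.log_le_log (Real.exp_pos _) hq
  have hlogpos : 0 ≤ Real.log (t * (1 - t) / (1 / 4 * S₂)) := le_trans (by positivity) hlog
  have hmain : 4 * N ≤ t * (1 - t) * Real.log (t * (1 - t) / (1 / 4 * S₂)) := by
    calc 4 * N = u₀ * (4 * N / u₀) := by field_simp
      _ ≤ t * (1 - t) * (4 * N / u₀) := by gcongr
      _ ≤ t * (1 - t) * Real.log (t * (1 - t) / (1 / 4 * S₂)) := by gcongr
  linarith

end Summit.CriticalPhenomena.CardyFormulaZ2.Theorems.CardySelfRefinement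

end
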